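import Literature.AlgebraicGeometry.Motives.AbelianVarietyLie
import HarnessLib

/-!
# Translation of tangent vectors: a homomorphism with zero tangent map at the origin has zero
# tangent map at every point (Shimura 1998, §2.8; Görtz–Wedhorn II, Rem. 27.18)

Topic `Literature/AlgebraicGeometry/Motives`, namespace `Literature.AlgebraicGeometry.Motives.AbelianVariety`.
Theorems only (no definition, no named fact; net Literature debt 0).  Cell `hodgecm-mathlib` (D-0151),
fan A rung A-II (h21), EDITION E2 «height-one road» for the degree-one Shimura–Taniyama congruence,
piece L2a of A-p02's memo `ROAD-E2-heightOne-S2degOne.md` §5.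

Shimura, *Abelian Varieties with Complex Multiplication*, §2.8, works with the differential
`δλ : 𝔇₀(B) → 𝔇₀(A)` of a homomorphism `λ : A → B` on INVARIANT differential forms; invariance is the
statement that the tangent map of `λ` at every point is the translate of the tangent map at the
origin.  We record that statement in the currency of points with values in an augmented `K`-algebra
(Görtz–Wedhorn II, Rem. 27.18 (4): `Lie(A) = Ker(A(K[ε]) → A(K))`; the tree's `AbelianVarietyLie`):
let `ι₀ : R₀ → R`, `aug : R → R₀` be `K`-algebra maps with `aug ∘ ι₀ = id` (e.g. `R = L[ε]`, `R₀ = L`).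

* `augMap_comp_liftAlongAug_inv_mul_eq_one` — every `R`-point `t` of `A` is `t = t₀ · t₁` with
  `t₀ = (Spec ι₀ ≫ Spec aug ≫ t)` the «constant lift of its reduction» and `t₁ := t₀⁻¹ t` a point AT
  THE ORIGIN (`Spec aug ≫ t₁ = 1`): the group law translates any point to the origin.
* `comp_eq_lift_comp_of_forall_augMap_comp_eq_one` — **translation**: if a homomorphism `f : A → B`
  kills every `R`-point at the origin (`Spec aug ≫ t₁ = 1 ⇒ t₁ ≫ f = 1`), then for EVERY `R`-point
  `t` of `A`, `t ≫ f = Spec ι₀ ≫ Spec aug ≫ t ≫ f` — i.e. `f ∘ t` is the constant lift of its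
  reduction; for `R = L[ε]` this says that the tangent map of `f` vanishes at every `L`-point.
* `forall_augMap_comp_eq_one_iff` — conversely the conclusion for all `t` implies the hypothesis;
* `comp_eq_lift_comp_of_forall_tangent_comp_eq_one` — the case `R = L[ε]`, `R₀ = L` (tangent vectors).

## References

* [Shimura1998] G. Shimura, *Abelian Varieties with Complex Multiplication and Modular Functions*,
  Princeton 1998, §2.8 (invariant differentials `𝔇₀`, the differential `δλ`; Prop. 6).
* [GortzWedhorn2023] U. Görtz, T. Wedhorn, *Algebraic Geometry II*, Rem. 27.18 (1)–(4), (27.4.6).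
-/

universe u

open CategoryTheory AlgebraicGeometry
open scoped MonObj

noncomputable section

namespace Literature.AlgebraicGeometry.Motives

namespace AbelianVariety

open AlgPoints

variable {K : Type u} [Field K] {A B : AbelianVariety K}
variable {R R₀ : Type u} [CommRing R] [Algebra K R] [CommRing R₀] [Algebra K R₀]
  (ι₀ : R₀ →ₐ[K] R) (aug : R →ₐ[K] R₀)

/-- `Spec aug ≫ Spec ι₀ = 𝟙` when `aug ∘ ι₀ = id` (functoriality of `Spec`). [folklore] -/
private theorem augMap_comp_liftMap (h : aug.comp ι₀ = AlgHom.id K R₀) :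
    specOverMapOfAlgHom aug ≫ specOverMapOfAlgHom ι₀ = 𝟙 (specOver K R₀) := by
  rw [specOverMapOfAlgHom_comp, h, specOverMapOfAlgHom_id]

/-- **Translating a point to the origin.**  For an `R`-point `t` of `A` and
`t₀ := Spec ι₀ ≫ Spec aug ≫ t` (the constant lift of its reduction `Spec aug ≫ t`), the point
`t₀⁻¹ · t` lies at the origin: `Spec aug ≫ (t₀⁻¹ · t) = 1` (Görtz–Wedhorn II, Rem. 27.18 (4): every
`R`-point differs from a point of `Ker(A(R) → A(R₀))` by a translation). [cite: GortzWedhorn2023, Rem. 27.18 (4) and (27.4.6)] -/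
theorem augMap_comp_liftAlongAug_inv_mul_eq_one (h : aug.comp ι₀ = AlgHom.id K R₀)
    (t : specOver K R ⟶ A.X) :
    specOverMapOfAlgHom aug ≫
        ((specOverMapOfAlgHom ι₀ ≫ specOverMapOfAlgHom aug ≫ t)⁻¹ * t) = 1 := by
  rw [MonObj.comp_mul, GrpObj.comp_inv, ← Category.assoc, augMap_comp_liftMap ι₀ aug h,
    Category.id_comp, inv_mul_cancel]

/-- **Translation of tangent vectors** (Shimura §2.8: the differential of a homomorphism on invariant
forms; Görtz–Wedhorn II Rem. 27.18): let `f : A → B` be a homomorphism of abelian varieties which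
kills every `R`-point of `A` at the origin (w.r.t. the augmentation `aug : R → R₀` with section
`ι₀`).  Then for EVERY `R`-point `t` of `A`, `t ≫ f` is the constant lift of its reduction:
`t ≫ f = Spec ι₀ ≫ Spec aug ≫ t ≫ f`.  For `R = L[ε]`, `R₀ = L`: if the tangent map of `f` vanishes at
the origin (on `L`-valued tangent vectors), it vanishes at every `L`-point.
[cite: Shimura1998, §2.8 (differentials of homomorphisms), Prop. 6] [cite: GortzWedhorn2023, Rem. 27.18 (1)–(4)] -/
theorem comp_eq_lift_comp_of_forall_augMap_comp_eq_one (h : aug.comp ι₀ = AlgHom.id K R₀)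
    (f : A ⟶ B)
    (hf : ∀ t : specOver K R ⟶ A.X, specOverMapOfAlgHom aug ≫ t = 1 → t ≫ f.hom.hom.hom = 1)
    (t : specOver K R ⟶ A.X) :
    t ≫ f.hom.hom.hom = specOverMapOfAlgHom ι₀ ≫ specOverMapOfAlgHom aug ≫ t ≫ f.hom.hom.hom := by
  set t₀ : specOver K R ⟶ A.X := specOverMapOfAlgHom ι₀ ≫ specOverMapOfAlgHom aug ≫ t with ht₀
  have hdec : t = t₀ * (t₀⁻¹ * t) := by rw [mul_inv_cancel_left]
  have h1 : (t₀⁻¹ * t) ≫ f.hom.hom.hom = 1 :=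
    hf _ (augMap_comp_liftAlongAug_inv_mul_eq_one ι₀ aug h t)
  calc t ≫ f.hom.hom.hom = (t₀ * (t₀⁻¹ * t)) ≫ f.hom.hom.hom := by rw [← hdec]
    _ = (t₀ ≫ f.hom.hom.hom) * ((t₀⁻¹ * t) ≫ f.hom.hom.hom) := MonObj.mul_comp _ _ _
    _ = t₀ ≫ f.hom.hom.hom := by rw [h1, mul_one]
    _ = specOverMapOfAlgHom ι₀ ≫ specOverMapOfAlgHom aug ≫ t ≫ f.hom.hom.hom := by
      rw [ht₀, Category.assoc, Category.assoc]

/-- The translation statement is EQUIVALENT to its hypothesis: `f` kills the `R`-points at the origin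
iff `t ≫ f` is the constant lift of its reduction for every `R`-point `t` (the converse direction:
for `t` at the origin the constant lift of the reduction of `t ≫ f` is `1`).
[cite: GortzWedhorn2023, Rem. 27.18 (1)–(4)] -/
theorem forall_augMap_comp_eq_one_iff (h : aug.comp ι₀ = AlgHom.id K R₀) (f : A ⟶ B) :
    (∀ t : specOver K R ⟶ A.X, specOverMapOfAlgHom aug ≫ t = 1 → t ≫ f.hom.hom.hom = 1) ↔
      ∀ t : specOver K R ⟶ A.X,
        t ≫ f.hom.hom.hom = specOverMapOfAlgHom ι₀ ≫ specOverMapOfAlgHom aug ≫ t ≫ f.hom.hom.hom := by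
  refine ⟨comp_eq_lift_comp_of_forall_augMap_comp_eq_one ι₀ aug h f, fun H t ht => ?_⟩
  rw [H t, ← Category.assoc (specOverMapOfAlgHom aug) t, ht, MonObj.one_comp, MonObj.comp_one]


/-! ### Tangent vectors: `R = L[ε]`, `R₀ = L` -/

section DualNumbers

open TrivSqZeroExt

variable (L : Type u) [CommRing L] [Algebra K L]

/-- The augmentation `L[ε] → L` is a retraction of the inclusion `L → L[ε]`. [folklore] -/
private theorem fstHom_comp_inlAlgHom : (fstHom K L L).comp (inlAlgHom K L L) = AlgHom.id K L := by
  ext x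
  rfl

/-- **Translation of tangent vectors, dual-number form** (Shimura §2.8; Görtz–Wedhorn II Rem. 27.18 (4),
`Lie(A) = Ker(A(K[ε]) → A(K))`): if a homomorphism `f : A → B` kills every `L[ε]`-point of `A` at the
origin (every `L`-valued tangent vector at `e`), then for every `L[ε]`-point `t` of `A` the point
`t ≫ f` of `B` is the constant lift `Spec(inl) ≫ Spec(fst) ≫ t ≫ f` of its reduction — the tangent map
of `f` vanishes at every `L`-point of `A`. [cite: Shimura1998, §2.8 (differentials of homomorphisms), Prop. 6]
[cite: GortzWedhorn2023, Rem. 27.18 (1)–(4)] -/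
theorem comp_eq_lift_comp_of_forall_tangent_comp_eq_one (f : A ⟶ B)
    (hf : ∀ t : specOver K (DualNumber L) ⟶ A.X,
      specOverMapOfAlgHom (fstHom K L L) ≫ t = 1 → t ≫ f.hom.hom.hom = 1)
    (t : specOver K (DualNumber L) ⟶ A.X) :
    t ≫ f.hom.hom.hom =
      specOverMapOfAlgHom (inlAlgHom K L L) ≫ specOverMapOfAlgHom (fstHom K L L) ≫
        t ≫ f.hom.hom.hom :=
  comp_eq_lift_comp_of_forall_augMap_comp_eq_one (inlAlgHom K L L) (fstHom K L L)
    (fstHom_comp_inlAlgHom L) f hf t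

end DualNumbers

end AbelianVariety

end Literature.AlgebraicGeometry.Motives

end
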